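import Literature.Computability.Complexity.TVCheckerMachine
import Literature.Computability.Complexity.AdaptiveQueries
import Literature.Computability.Complexity.OracleComposition
import Literature.Computability.Complexity.SameLengthCheckerMachine
import HarnessLib

/-!
# The downward self-reduction MACHINE of Trevisan–Vadhan's language (Impagliazzo–Wigderson's Def. 6
# form): two field values of the next level, one operator, queries strictly shorter than the input

Literature / complexity — the oracle machine realizing the functional downward self-reducibility
`QBFUniv.Fni_eq_of_queries` of `TVFunction.lean` (Trevisan–Vadhan 2007, Thm. 4.3 (b) with Lemma 4.1 (i):
"`h(n,i) > h(n,i+1)`, so that the reduction from `f_{n,i}` to `f_{n,i+1}` turns into a downward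
self-reduction for `F`"; Impagliazzo–Wigderson 1998, Def. 6: `f_n ≤ᵀₚ f_{n-1}`), in the transcript model of
`Oracle.lean` by the bounded adaptive-reduction algorithm `AdQuery.adAlg` (`AdaptiveQueries.lean`) over the
parsing bricks of `TVCheckerParse.lean`:

* `TVChk.dIn`, `dRec` (the input of the machine presented to the parsing / stage bricks as the record of a
  run with no coins, the answers as the carrier), `TVChk.dA0`, `dA1`, `dE` (the operator bricks
  `opQuantF`/`opLinF` on the coefficient block and the two reassembled values), **`TVChk.dOut`** (the
  verdict on `⟨x, answers⟩`: `0` off the canonical lengths, `1` at size `0`, the matrix bit at the last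
  stage, the operator bit otherwise; `dOut_eq_FB`), **`TVChk.dQry`** (the `k`-th query: the `blk n` words of
  `x[v ↦ 0]` then of `x[v ↦ 1]` at length `h n (i+1) < |x|`, then the empty word; `dQry_length_lt`);
* **`TVChk.dsrAlg : OracleAlg (List Bool)`** (`adAlg dQry (2X) {⟨x,a⟩ | dOut = 1}` with outputs re-presented
  as one-bit strings, `OracleAlg.mapOut`), `dsrAlg_isPolyTime`, and **`TVChk.dsrAlg_run`**: against EVERY
  oracle answering `LTV` on the words shorter than `x`, within `2|x| + 1` rounds the machine outputs
  `[x ∈ LTV]` — the hypothesis `hdsr` of `MurrayWilliams2018_NQP_not_subset_ACC0_of_LTV`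
  (`TVCheckerMachine.lean`) and of `IWUniform.mem_BPP_of_dsr_of_stronglyConstructible`;
* hence **`MurrayWilliams2018_NQP_not_subset_ACC0_of_isHard_LTV`** (with `TVCheckerMachine.lean`): the
  headline from the `PSPACE`-hardness of `LTV` ALONE; `MurrayWilliams2018_thm_2_2_language_of_isHard_LTV`,
  `MurrayWilliams2018_lemma_4_1_ae_of_isHard_LTV_of_umansGenerator`.

Everything is proved; no named fact is introduced (D-0026).

## References

* L. Trevisan, S. Vadhan, Comput. Complexity 16 (2007), Thm. 4.3 (proof, (b)), Lemma 4.1 (i)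
  [TrevisanVadhan2007].
* R. Impagliazzo, A. Wigderson, *Randomness vs. time: de-randomization under a uniform assumption*,
  JCSS 63 (2001), Def. 6 [ImpagliazzoWigderson2001].
* S. Arora, B. Barak, CUP 2009, §3.4 (oracle machines), §8.3.3 [AroraBarakCC2009].
-/

noncomputable section

namespace Literature.Computability.Complexity

open _root_.Computability Polynomial Finset Brick Plumb GF2Str HardLangM TVBrick QBFUniv SelfCorrect
  Literature.InformationTheory.Coding

namespace TVChk

/-! ### The record of the machine -/

/-- The machine's input `⟨x, a⟩` (word, answer bits so far) as the input record `⟨⟨x, ε⟩, a⟩` of the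
parsing bricks (no coins; the answers travel as the carrier). [folklore] -/
def dIn : List Bool → List Bool := fanoutFn (fanoutFn fstF (fun _ => [])) sndF

/-- The stage record `⟨core, ⟨1⁰, 1⁰⟩⟩` of the machine's input. [folklore] -/
def dRec : List Bool → List Bool := fanoutFn (coreU ∘ dIn) (fun _ => boolPair [] [])

/-- These are in `FP`. [folklore] -/
theorem dRec_mem_FP : dIn ∈ FP ∧ dRec ∈ FP :=
  have h : dIn ∈ FP := fanoutFn_mem_FP (fanoutFn_mem_FP fstF_mem_FP (const_mem_FP _)) sndF_mem_FP
  ⟨h, fanoutFn_mem_FP (comp_mem_FP parse_mem_FP.2.2.2.2.2 h) (const_mem_FP _)⟩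

/-- Value of `dIn`. [folklore] -/
theorem dIn_apply (x a : List Bool) : dIn (boolPair x a) = boolPair (boolPair x []) a := by simp [dIn]

/-- Value of `dRec` (`ptLen n ≤ |x|`). [folklore] -/
theorem dRec_apply (x a : List Bool) (hx : ptLen (nOf x.length) ≤ x.length) :
    dRec (boolPair x a) = stRec (coreRec x [] a (nOf x.length) (iOf x.length) (mlen (nOf x.length) - iOf x.length)
      (pre (nOf x.length) + (mlen (nOf x.length) - iOf x.length)) (modStr (Mof (nOf x.length)))) 0 0 := by
  rw [dRec, fanoutFn_apply, Function.comp_apply, dIn_apply, coreU_apply x [] a hx, stRec]; rfl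

/-- The point fold with no rounds: the start point. [folklore] -/
theorem pointF_apply_zero (w r e : List Bool) (n i m' Z t : ℕ) :
    pointF (stRec (coreRec w r e n i m' Z (modStr (Mof n))) t 0) = ptBits n (xOf n w) := by
  set S := stRec (coreRec w r e n i m' Z (modStr (Mof n))) t 0 with hSdef
  obtain ⟨-, -, -, -, -, -, -, -, -, hS⟩ := q_apply w r e n i m' Z (modStr (Mof n)) t 0
  have hk : 0 ≤ (X : Polynomial ℕ).eval S.length := Nat.zero_le _
  have hinit : initPt S = boolPair S (boolPair (encodeNat 0) (boolPair (ones 0) (ptBits n (xOf n w)))) := by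
    simp only [initPt, fanoutFn_apply, Function.comp_apply, hS, lenBinF_apply, ones, List.length_replicate, hSdef, pt0Of_apply]
    rfl
  rw [pointF, Function.comp_apply, Function.comp_apply, hinit, foldLoop_apply _ _ hk, sndPow_succ_boolPair, sndPow_succ_boolPair,
    sndPow_zero_boolPair, foldAcc_zero]

/-! ### The verdict on `⟨x, answers⟩` -/

/-- The first answer block `a ↾ blk n`. [folklore] -/
def dA0 : List Bool → List Bool := takeFn ∘ fanoutFn blkS qE
/-- The second answer block `(a ⇂ blk n) ↾ blk n`. [folklore] -/
def dA1 : List Bool → List Bool := takeFn ∘ fanoutFn blkS (dropFn ∘ fanoutFn blkS qE)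
/-- The arguments `⟨⟨coef, ⟨A₀, A₁⟩⟩, f⟩` of the operator bricks. [folklore] -/
def dArgs : List Bool → List Bool := fanoutFn (fanoutFn coefS (fanoutFn dA0 dA1)) qF
/-- **The operator's value** on the two reassembled answers (`opValue`, as bits). [cite: TrevisanVadhan2007, Lemma 4.1 (i)] -/
def dE : List Bool → List Bool := iteFn isQS (opQuantF ∘ dArgs) (opLinF ∘ dArgs)
/-- The verdict on the stage record: the matrix bit at the last stage, else the operator bit. [cite: TrevisanVadhan2007, Thm. 4.3 (proof)] -/
def dOutRec : List Bool → List Bool := iteFn (isNilFn ∘ qM) (bitAtS matS) (bitAtS dE)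
/-- **The verdict** on `⟨x, answers⟩`: `0` off the canonical lengths, `1` at size `0`, else `dOutRec`.
[cite: TrevisanVadhan2007, Thm. 4.3 (proof)] -/
def dOut : List Bool → List Bool :=
  iteFn (canonU ∘ dIn) (iteFn (isNilFn ∘ szU ∘ dIn) (fun _ => [true]) (dOutRec ∘ dRec)) (fun _ => [false])

/-- These are in `FP`. [folklore] -/
theorem dOut_mem_FP : dA0 ∈ FP ∧ dA1 ∈ FP ∧ dArgs ∈ FP ∧ dE ∈ FP ∧ dOutRec ∈ FP ∧ dOut ∈ FP := by
  obtain ⟨hb, -, -⟩ := jIx_mem_FP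
  obtain ⟨-, -, hE, -, -, hM, -, hF, -, -⟩ := q_mem_FP
  obtain ⟨hco, -, -, -, -⟩ := rule_mem_FP fstF_mem_FP
  obtain ⟨-, -, -, -, hq, -, -, -⟩ := stageData_mem_FP
  have h0 : dA0 ∈ FP := comp_mem_FP takeFn_mem_FP (fanoutFn_mem_FP hb hE)
  have h1 : dA1 ∈ FP := comp_mem_FP takeFn_mem_FP (fanoutFn_mem_FP hb (comp_mem_FP dropFn_mem_FP (fanoutFn_mem_FP hb hE)))
  have ha : dArgs ∈ FP := fanoutFn_mem_FP (fanoutFn_mem_FP hco (fanoutFn_mem_FP h0 h1)) hF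
  have he : dE ∈ FP := iteFn_mem_FP hq (comp_mem_FP opQuantF_mem_FP ha) (comp_mem_FP opLinF_mem_FP ha)
  have hor : dOutRec ∈ FP := iteFn_mem_FP (comp_mem_FP isNilFn_mem_FP hM) (bitAtS_mem_FP matS_mem_FP) (bitAtS_mem_FP he)
  obtain ⟨hin, hrec⟩ := dRec_mem_FP
  obtain ⟨-, -, -, hn, hc, -⟩ := parse_mem_FP
  exact ⟨h0, h1, ha, he, hor, iteFn_mem_FP (comp_mem_FP hc hin) (iteFn_mem_FP (comp_mem_FP isNilFn_mem_FP (comp_mem_FP hn hin))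
    (const_mem_FP _) (comp_mem_FP hor hrec)) (const_mem_FP _)⟩

section Verdict

variable {n : ℕ} (hn : 0 < n) (x : List Bool) {i m' Z : ℕ}

/-- The stage data of the machine's record (stage `i` itself, `s = 0`). [folklore] -/
theorem stageData_apply_zero (hi : i < mlen n) (a : List Bool) :
    axisS (stRec (coreRec x [] a n i m' Z (modStr (Mof n))) 0 0) = ones (opVar (opAt n hn i)).val ∧
    selS (stRec (coreRec x [] a n i m' Z (modStr (Mof n))) 0 0) = ones (lay n (.s ⟨i / (N n + 1), block_lt_of_lt_mlen hi⟩)).val ∧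
    isQS (stRec (coreRec x [] a n i m' Z (modStr (Mof n))) 0 0) = [decide (i % (N n + 1) = 0)] := by
  have hc0 : sctxS (stRec (coreRec x [] a n i m' Z (modStr (Mof n))) 0 0) = sCtx n i := sctxS_apply x [] a
  refine ⟨?_, ?_, ?_⟩
  · rw [axisS, Function.comp_apply, hc0, axisOf_apply hi, opAt_eq hn hi]
  · rw [selS, Function.comp_apply, hc0, selOf_apply hi]
  · rw [isQS, Function.comp_apply, hc0, (sdata_apply n i).2.2]

/-- **The operator's value on genuine answer blocks**: with the first `2 blk n` answer bits the bits of
the two values `V₀, V₁`, `dE` returns the bits of `opValue (uops n)[i] (xOf n x) V₀ V₁`. [cite: TrevisanVadhan2007, Lemma 4.1 (i)] -/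
theorem dE_apply (hi : i < mlen n) (g0 g1 : Fin (blk n) → Bool) (rest : List Bool) :
    dE (stRec (coreRec x [] (List.ofFn g0 ++ List.ofFn g1 ++ rest) n i m' Z (modStr (Mof n))) 0 0) =
      bits (Mof n) (opValue (opAt n hn i) (xOf n x) (decF (Mof n) g0) (decF (Mof n) g1)) := by
  set a := List.ofFn g0 ++ List.ofFn g1 ++ rest with ha
  set S := stRec (coreRec x [] a n i m' Z (modStr (Mof n))) 0 0 with hSdef
  obtain ⟨hax, hsel, hQ⟩ := stageData_apply_zero hn x (m' := m') (Z := Z) hi a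
  obtain ⟨-, -, hE, -, -, -, -, hF, -, -⟩ := q_apply x [] a n i m' Z (modStr (Mof n)) 0 0
  have hb : blkS S = (modStr (Mof n)).drop 1 := by rw [blkS, Function.comp_apply, fanoutFn_apply, hF, dropFn_boolPair, List.length_singleton]
  have hbl : ((modStr (Mof n)).drop 1).length = blk n := by rw [List.length_drop, (modStr_top _).1]; rfl
  have h0 : dA0 S = bits (Mof n) (decF (Mof n) g0) := by
    rw [dA0, Function.comp_apply, fanoutFn_apply, hb, hE, takeFn_boolPair, hbl, ha, List.append_assoc,
      List.take_append_of_le_length (by simp), List.take_of_length_le (by simp), bits_decF]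
  have h1 : dA1 S = bits (Mof n) (decF (Mof n) g1) := by
    rw [dA1, Function.comp_apply, fanoutFn_apply, hb, Function.comp_apply, fanoutFn_apply, hb, hE, dropFn_boolPair, hbl, takeFn_boolPair, hbl,
      ha, List.append_assoc, List.drop_append_of_le_length (by simp), List.drop_eq_nil_of_le (by simp), List.nil_append,
      List.take_append_of_le_length (by simp), List.take_of_length_le (by simp), bits_decF]
  have hpt : pointF S = ptBits n (xOf n x) := pointF_apply_zero x [] a n i m' Z 0
  have hargs : ∀ idx : Fin (N n), iteFn isQS selS axisS S = ones idx.val →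
      dArgs S = boolPair (boolPair (bits (Mof n) (xOf n x idx)) (boolPair (bits (Mof n) (decF (Mof n) g0)) (bits (Mof n) (decF (Mof n) g1))))
        (modStr (Mof n)) := by
    intro idx hidx
    rw [dArgs, fanoutFn_apply, fanoutFn_apply, fanoutFn_apply, h0, h1, hF, coefS, Function.comp_apply, fanoutFn_apply, fanoutFn_apply, hpt, hidx, hF,
      ← List.append_nil (ptBits n (xOf n x)), blockAt_ptBits]
  rw [dE, iteFn_apply hQ]
  rcases op_cases hn hi with ⟨hmod, hop⟩ | ⟨v, hmod, hop⟩
  · rw [decide_eq_true hmod, if_pos rfl, Function.comp_apply,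
      hargs (lay n (.s ⟨i / (N n + 1), block_lt_of_lt_mlen hi⟩)) (by rw [iteFn_apply hQ, decide_eq_true hmod, if_pos rfl, hsel]),
      opQuantF_apply, opQuantStr_bits, hop, opValue]
  · rw [hmod, decide_eq_false (Nat.succ_ne_zero _), if_neg Bool.false_ne_true, Function.comp_apply,
      hargs v (by rw [iteFn_apply hQ, hmod, decide_eq_false (Nat.succ_ne_zero _), if_neg Bool.false_ne_true, hax, hop, opVar]),
      opLinF_apply, opLinStr_bits, hop, opValue]

end Verdict

/-- **The verdict is `F`** on genuine answers: for every word `x` and answer string `a` whose first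
`2 blk n` bits are, whenever `x` is canonical of positive size at a stage `i < mlen n`, the bits of `F` at
the `blk n` words of `xOf x [v ↦ 0]` and of `xOf x [v ↦ 1]` at length `h n (i+1)` (`v` the operator's
variable), `dOut ⟨x, a⟩ = [F x]`. [cite: TrevisanVadhan2007, Thm. 4.3 (proof, (b))] -/
theorem dOut_eq_FB (x a : List Bool)
    (ha : ptLen (nOf x.length) + blk (nOf x.length) ≤ x.length - pre (nOf x.length) → 0 < nOf x.length →
      ∀ hi : iOf x.length < mlen (nOf x.length), ∃ rest : List Bool,
        a = (List.ofFn fun l : Fin (blk (nOf x.length)) => FB (wordOf (nOf x.length)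
              (Function.update (xOf (nOf x.length) x) (opVar ((uops (nOf x.length))[iOf x.length]'(by rwa [mlen] at hi))) 0) l
              (h (nOf x.length) (iOf x.length + 1)))) ++
            (List.ofFn fun l : Fin (blk (nOf x.length)) => FB (wordOf (nOf x.length)
              (Function.update (xOf (nOf x.length) x) (opVar ((uops (nOf x.length))[iOf x.length]'(by rwa [mlen] at hi))) 1) l
              (h (nOf x.length) (iOf x.length + 1)))) ++ rest) :
    dOut (boolPair x a) = [FB x] := by
  obtain ⟨hn, hc, -, hm, -, -⟩ := parse_apply x [] a
  rw [← dIn_apply] at hn hc hm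
  have hz : (isNilFn ∘ szU ∘ dIn) (boolPair x a) = [decide (nOf x.length = 0)] := by
    rw [Function.comp_apply, Function.comp_apply, hn, isNilFn]; simp [ones, List.replicate_eq_nil_iff]
  rcases FB_cases x with ⟨hnc, hF⟩ | ⟨hcan, hF, -⟩
  · -- off the canonical lengths
    rw [dOut, iteFn_apply (by rw [Function.comp_apply, hc]), decide_eq_false (fun h => hnc ((canonical_iff _).2 h)), if_neg Bool.false_ne_true, hF]
  · have hcan' := (canonical_iff x.length).1 hcan
    rw [dOut, iteFn_apply (by rw [Function.comp_apply, hc]), decide_eq_true hcan', if_pos rfl, iteFn_apply hz]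
    rcases Nat.eq_zero_or_pos (nOf x.length) with h0 | hpos
    · rw [decide_eq_true h0, if_pos rfl, hF, h0, Fni_size_zero]
    · rw [decide_eq_false (Nat.pos_iff_ne_zero.1 hpos), if_neg Bool.false_ne_true, Function.comp_apply,
        dRec_apply x a (le_trans (by omega : ptLen (nOf x.length) ≤ pre (nOf x.length) + ptLen (nOf x.length) + blk (nOf x.length)) hcan'), hF]
      set n := nOf x.length with hnn
      set i := iOf x.length with hii
      have hile : i ≤ mlen n := iOf_le _
      obtain ⟨-, -, hMt⟩ := conj_tests x [] a n i (mlen n - i) (pre n + (mlen n - i)) (modStr (Mof n)) 0 0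
      rw [dOutRec, iteFn_apply hMt]
      rcases Nat.lt_or_ge i (mlen n) with hlt | hge
      · -- a genuine stage: the operator bit, `Fni_eq_of_queries`
        obtain ⟨rest, rfl⟩ := ha hcan hpos hlt
        rw [decide_eq_false (show mlen n - i ≠ 0 from fun h0 => absurd (Nat.le_of_sub_eq_zero h0) (not_le.2 hlt)), if_neg Bool.false_ne_true,
          bitAtS_apply x [] _ n i (mlen n - i) _ 0 0 (dE_apply hpos x hlt _ _ rest), goodBit, Fni_eq_of_queries hlt, opAt_eq hpos hlt]
        rfl
      · -- the last stage: the matrix bit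
        have hieq : i = mlen n := le_antisymm hile hge
        rw [decide_eq_true (Nat.sub_eq_zero_of_le hge), if_pos rfl]
        have hwl : ptLen n ≤ x.length := le_trans (by omega : ptLen n ≤ pre n + ptLen n + blk n) hcan'
        have hM := matS_apply hpos (w := x) hwl [] a (i := i) (m' := mlen n - i) (Z := pre n + (mlen n - i)) (t := 0) (s := 0)
          (Nat.zero_le _) (le_of_eq (Nat.add_sub_cancel' hile)) (by rw [Nat.sub_eq_zero_of_le hge]; simp)
        simp only [ChainCheck.Chain.pointSeq_zero] at hM
        rw [bitAtS_apply x [] a n i _ _ 0 0 hM, goodBit, hieq, Fni_mlen]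

/-! ### The queries -/

/-- `1ᵏ`, `k = |a|` the number of answers received. [folklore] -/
def dK : List Bool → List Bool := polyFn X ∘ sndF
/-- `1^{blk n}` (all ones, for the division brick). [folklore] -/
def dBlk : List Bool → List Bool := polyFn X ∘ blkS ∘ dRec
/-- `⟨1^{k / blk n}, 1^{k % blk n}⟩`. [folklore] -/
def dDM : List Bool → List Bool := udivmodF ∘ fanoutFn dK dBlk
/-- The value written on the axis: `0` for the first block of queries, `1` for the second. [folklore] -/
def dRho : List Bool → List Bool := iteFn (isNilFn ∘ fstF ∘ dDM) (zeroFrom (qF ∘ dRec)) (oneFrom (qF ∘ dRec))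
/-- The shifted point `P₀[v ↦ ρ]`. [folklore] -/
def dPt : List Bool → List Bool :=
  writeOpF ∘ fanoutFn (pointF ∘ dRec) (fanoutFn (fanoutFn (axisS ∘ dRec) (qF ∘ dRec)) dRho)
/-- **The genuine query**: the word of the shifted point with selector `k % blk n` at length `h n (i+1)`. [cite: TrevisanVadhan2007, Thm. 4.3 (proof, (b))] -/
def dWord : List Bool → List Bool :=
  qwordF ∘ fanoutFn (fanoutFn dPt (fanoutFn (fanoutFn (zcS ∘ dRec) (qF ∘ dRec)) (qE ∘ dRec))) (sndF ∘ dDM)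
/-- **The query generator**: the genuine query while canonical of positive size, not at the last
stage, and fewer than `2 blk n` answers are in; the empty word otherwise. [cite: TrevisanVadhan2007, Thm. 4.3 (proof, (b))] [cite: ImpagliazzoWigderson2001, Def. 6] -/
def dQry : List Bool → List Bool :=
  iteFn (canonU ∘ dIn)
    (iteFn (isNilFn ∘ szU ∘ dIn) (fun _ => [])
      (iteFn (isNilFn ∘ qM ∘ dRec) (fun _ => [])
        (iteFn (ltLenF ∘ fanoutFn dK (appF ∘ fanoutFn dBlk dBlk)) dWord (fun _ => []))))
    (fun _ => [])

/-- These are in `FP`. [folklore] -/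
theorem dQry_mem_FP : dQry ∈ FP := by
  obtain ⟨hin, hrec⟩ := dRec_mem_FP
  obtain ⟨hb, -, -⟩ := jIx_mem_FP
  obtain ⟨-, -, hE, -, -, hM, -, hF, -, -⟩ := q_mem_FP
  obtain ⟨-, hax, -, -, -, hzc, -, -⟩ := stageData_mem_FP
  obtain ⟨-, -, -, hn, hc, -⟩ := parse_mem_FP
  have hK : dK ∈ FP := comp_mem_FP (polyFn_mem_FP _) sndF_mem_FP
  have hBl : dBlk ∈ FP := comp_mem_FP (polyFn_mem_FP _) (comp_mem_FP hb hrec)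
  have hDM : dDM ∈ FP := comp_mem_FP udivmodF_mem_FP (fanoutFn_mem_FP hK hBl)
  have hFr : (qF ∘ dRec) ∈ FP := comp_mem_FP hF hrec
  have hRho : dRho ∈ FP := iteFn_mem_FP (comp_mem_FP isNilFn_mem_FP (comp_mem_FP fstF_mem_FP hDM)) (zeroFrom_mem_FP hFr) (oneFrom_mem_FP hFr)
  have hPt : dPt ∈ FP := comp_mem_FP writeOpF_mem_FP (fanoutFn_mem_FP (comp_mem_FP pointF_mem_FP hrec)
    (fanoutFn_mem_FP (fanoutFn_mem_FP (comp_mem_FP hax hrec) hFr) hRho))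
  have hW : dWord ∈ FP := comp_mem_FP qwordF_mem_FP (fanoutFn_mem_FP (fanoutFn_mem_FP hPt (fanoutFn_mem_FP
    (fanoutFn_mem_FP (comp_mem_FP hzc hrec) hFr) (comp_mem_FP hE hrec))) (comp_mem_FP sndF_mem_FP hDM))
  exact iteFn_mem_FP (comp_mem_FP hc hin) (iteFn_mem_FP (comp_mem_FP isNilFn_mem_FP (comp_mem_FP hn hin)) (const_mem_FP _)
    (iteFn_mem_FP (comp_mem_FP isNilFn_mem_FP (comp_mem_FP hM hrec)) (const_mem_FP _)
      (iteFn_mem_FP (comp_mem_FP ltLenF_mem_FP (fanoutFn_mem_FP hK (comp_mem_FP appF_mem_FP (fanoutFn_mem_FP hBl hBl)))) hW (const_mem_FP _))))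
    (const_mem_FP _)

/-- The guards of the query generator. [folklore] -/
theorem dQry_guards (x a : List Bool) :
    (canonU ∘ dIn) (boolPair x a) = [decide (pre (nOf x.length) + ptLen (nOf x.length) + blk (nOf x.length) ≤ x.length)] ∧
    (isNilFn ∘ szU ∘ dIn) (boolPair x a) = [decide (nOf x.length = 0)] := by
  obtain ⟨hn, hc, -, -, -, -⟩ := parse_apply x [] a
  rw [← dIn_apply] at hn hc
  refine ⟨hc, ?_⟩
  rw [Function.comp_apply, Function.comp_apply, hn, isNilFn]; simp [ones, List.replicate_eq_nil_iff]

/-- **The query generator off its genuine case returns the empty word.** [folklore] -/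
theorem dQry_eq_nil (x a : List Bool)
    (h : ¬ (ptLen (nOf x.length) + blk (nOf x.length) ≤ x.length - pre (nOf x.length) ∧ 0 < nOf x.length ∧
      iOf x.length < mlen (nOf x.length) ∧ a.length < 2 * blk (nOf x.length))) :
    dQry (boolPair x a) = [] := by
  obtain ⟨hc, hz⟩ := dQry_guards x a
  rw [dQry, iteFn_apply hc]
  by_cases hcan : pre (nOf x.length) + ptLen (nOf x.length) + blk (nOf x.length) ≤ x.length
  · have hcan' := (canonical_iff x.length).2 hcan
    rw [decide_eq_true hcan, if_pos rfl, iteFn_apply hz]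
    rcases Nat.eq_zero_or_pos (nOf x.length) with h0 | hpos
    · rw [decide_eq_true h0, if_pos rfl]
    · rw [decide_eq_false (Nat.pos_iff_ne_zero.1 hpos), if_neg Bool.false_ne_true]
      have hwl : ptLen (nOf x.length) ≤ x.length :=
        le_trans (by omega : ptLen (nOf x.length) ≤ pre (nOf x.length) + ptLen (nOf x.length) + blk (nOf x.length)) hcan
      obtain ⟨-, -, hMt⟩ := conj_tests x [] a (nOf x.length) (iOf x.length) (mlen (nOf x.length) - iOf x.length)
        (pre (nOf x.length) + (mlen (nOf x.length) - iOf x.length)) (modStr (Mof (nOf x.length))) 0 0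
      have hile := iOf_le x.length
      rw [iteFn_apply (by rw [Function.comp_apply, Function.comp_apply, dRec_apply x a hwl]; exact hMt)]
      by_cases hlt : iOf x.length < mlen (nOf x.length)
      · rw [decide_eq_false (show mlen (nOf x.length) - iOf x.length ≠ 0 from fun h0 =>
          absurd (Nat.le_of_sub_eq_zero h0) (not_le.2 hlt)), if_neg Bool.false_ne_true]
        have hK : (ltLenF ∘ fanoutFn dK (appF ∘ fanoutFn dBlk dBlk)) (boolPair x a) = [decide (a.length < 2 * blk (nOf x.length))] := by
          have hbl : dBlk (boolPair x a) = ones (blk (nOf x.length)) := by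
            rw [dBlk, Function.comp_apply, Function.comp_apply, dRec_apply x a hwl, blkS, Function.comp_apply, fanoutFn_apply,
              (q_apply x [] a _ _ _ _ _ 0 0).2.2.2.2.2.2.2.1, dropFn_boolPair, polyFn_apply, eval_X, List.length_drop, List.length_singleton,
              (modStr_top _).1]
            rfl
          rw [Function.comp_apply, fanoutFn_apply, dK, Function.comp_apply, sndF_boolPair, polyFn_apply, eval_X, Function.comp_apply, fanoutFn_apply,
            hbl, appF_boolPair, ltLenF_boolPair]
          simp [ones, two_mul]
        rw [iteFn_apply hK, decide_eq_false (fun hk => h ⟨hcan', hpos, hlt, hk⟩), if_neg Bool.false_ne_true]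
      · rw [decide_eq_true (Nat.sub_eq_zero_of_le (not_lt.1 hlt)), if_pos rfl]
  · rw [decide_eq_false hcan, if_neg Bool.false_ne_true]

/-- **The genuine queries**: with `k = |a| < 2 blk n` answers in, canonical `x` of positive size at a
stage `i < mlen n`, the query is the word of `xOf x [v ↦ 0]` (`k < blk n`) resp. `xOf x [v ↦ 1]` with
selector `k % blk n` at length `h n (i+1)`, `v` the variable of the stage's operator.
[cite: TrevisanVadhan2007, Thm. 4.3 (proof, (b))] -/
theorem dQry_apply (x a : List Bool) (hc : ptLen (nOf x.length) + blk (nOf x.length) ≤ x.length - pre (nOf x.length))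
    (hpos : 0 < nOf x.length) (hi : iOf x.length < mlen (nOf x.length)) (hk : a.length < 2 * blk (nOf x.length)) :
    dQry (boolPair x a) =
      wordOf (nOf x.length) (Function.update (xOf (nOf x.length) x) (opVar ((uops (nOf x.length))[iOf x.length]'(by rwa [mlen] at hi)))
        (if a.length < blk (nOf x.length) then 0 else 1)) ⟨a.length % blk (nOf x.length), Nat.mod_lt _ (blk_pos _)⟩
        (h (nOf x.length) (iOf x.length + 1)) := by
  set n := nOf x.length with hnn
  set i := iOf x.length with hii
  obtain ⟨hcg, hz⟩ := dQry_guards x a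
  have hcan' := (canonical_iff x.length).1 hc
  have hwl : ptLen n ≤ x.length := le_trans (by omega : ptLen n ≤ pre n + ptLen n + blk n) hcan'
  have hile : i ≤ mlen n := iOf_le _
  have hR := dRec_apply x a hwl
  obtain ⟨-, -, hE, -, -, -, -, hF, -, -⟩ := q_apply x [] a n i (mlen n - i) (pre n + (mlen n - i)) (modStr (Mof n)) 0 0
  obtain ⟨hax, -, -⟩ := stageData_apply_zero hpos x (m' := mlen n - i) (Z := pre n + (mlen n - i)) hi a
  obtain ⟨-, -, hMt⟩ := conj_tests x [] a n i (mlen n - i) (pre n + (mlen n - i)) (modStr (Mof n)) 0 0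
  have hk' : dK (boolPair x a) = ones a.length := by rw [dK, Function.comp_apply, sndF_boolPair, polyFn_apply, eval_X]
  have hbl : dBlk (boolPair x a) = ones (blk n) := by
    rw [dBlk, Function.comp_apply, Function.comp_apply, hR, blkS, Function.comp_apply, fanoutFn_apply, hF, dropFn_boolPair, polyFn_apply, eval_X,
      List.length_drop, List.length_singleton, (modStr_top _).1]
    rfl
  have hdm : dDM (boolPair x a) = boolPair (ones (a.length / blk n)) (ones (a.length % blk n)) := by
    rw [dDM, Function.comp_apply, fanoutFn_apply, hk', hbl, udivmodF_apply _ (blk_pos n)]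
  have hrho : dRho (boolPair x a) = bits (Mof n) (if a.length < blk n then 0 else 1) := by
    have hct : (isNilFn ∘ fstF ∘ dDM) (boolPair x a) = [decide (a.length / blk n = 0)] := by
      rw [Function.comp_apply, Function.comp_apply, hdm, fstF_boolPair, isNilFn]; simp [ones, List.replicate_eq_nil_iff]
    have hFr : (qF ∘ dRec) (boolPair x a) = modStr (Mof n) := by rw [Function.comp_apply, hR, hF]
    rw [dRho, iteFn_apply hct]
    by_cases hlt : a.length < blk n
    · rw [decide_eq_true (Nat.div_eq_of_lt hlt), if_pos rfl, zeroFrom_apply (Mof n) hFr, if_pos hlt]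
    · rw [decide_eq_false (by rw [Nat.div_eq_zero_iff]; omega), if_neg Bool.false_ne_true, oneFrom_apply (Mof n) hFr, if_neg hlt]
  have hpt : dPt (boolPair x a) = ptBits n (Function.update (xOf n x) (opVar (opAt n hpos i)) (if a.length < blk n then 0 else 1)) := by
    simp only [dPt, Function.comp_apply, fanoutFn_apply, hR]
    rw [pointF_apply_zero, hax, hF, hrho, writeOpF_apply]
  have hword : dWord (boolPair x a) = wordOf n (Function.update (xOf n x) (opVar (opAt n hpos i)) (if a.length < blk n then 0 else 1))
      ⟨a.length % blk n, Nat.mod_lt _ (blk_pos n)⟩ (h n (i + 1)) := by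
    simp only [dWord, Function.comp_apply, fanoutFn_apply]
    rw [hR, hpt, hdm, sndF_boolPair, zcS_apply, hF, hE, ← abCtx]
    have hlen : ptLen n + blk n + (pre n + (mlen n - i) - (0 + 1)) = h n (i + 1) := by rw [h]; omega
    rw [show ones (a.length % blk n) = ones (⟨a.length % blk n, Nat.mod_lt _ (blk_pos n)⟩ : Fin (blk n)).val from rfl, qwordF_apply, hlen]
  have hK : (ltLenF ∘ fanoutFn dK (appF ∘ fanoutFn dBlk dBlk)) (boolPair x a) = [decide (a.length < 2 * blk n)] := by
    rw [Function.comp_apply, fanoutFn_apply, hk', Function.comp_apply, fanoutFn_apply, hbl, appF_boolPair, ltLenF_boolPair]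
    simp [ones, two_mul]
  rw [dQry, iteFn_apply hcg, decide_eq_true hcan', if_pos rfl, iteFn_apply hz, decide_eq_false (Nat.pos_iff_ne_zero.1 hpos), if_neg Bool.false_ne_true,
    iteFn_apply (show (isNilFn ∘ qM ∘ dRec) (boolPair x a) = _ by rw [Function.comp_apply, Function.comp_apply, hR]; exact hMt),
    decide_eq_false (show mlen n - i ≠ 0 from fun h0 => absurd (Nat.le_of_sub_eq_zero h0) (not_le.2 hi)), if_neg Bool.false_ne_true,
    iteFn_apply hK, decide_eq_true hk, if_pos rfl, hword, opAt_eq hpos hi]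

/-- **Every query is strictly shorter than a nonempty input.** [cite: TrevisanVadhan2007, Thm. 4.3 (proof, (b): "h(n,i) > h(n,i+1)")] [cite: ImpagliazzoWigderson2001, Def. 6] -/
theorem dQry_length_lt (x a : List Bool) (hx : 0 < x.length) : (dQry (boolPair x a)).length < x.length := by
  by_cases hg : ptLen (nOf x.length) + blk (nOf x.length) ≤ x.length - pre (nOf x.length) ∧ 0 < nOf x.length ∧
      iOf x.length < mlen (nOf x.length) ∧ a.length < 2 * blk (nOf x.length)
  · obtain ⟨hc, hpos, hi, hk⟩ := hg
    rw [dQry_apply x a hc hpos hi hk, length_wordOf _ _ _ (by rw [h]; omega)]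
    rcases h_nOf_iOf x hc with heq | ⟨h0, hlt⟩
    · calc h (nOf x.length) (iOf x.length + 1) < h (nOf x.length) (iOf x.length) := h_lt_h (Nat.lt_succ_self _) hi
        _ = x.length := heq
    · rw [h0]; rw [h0] at hi; exact lt_of_le_of_lt (by rw [h, h]; omega) hlt
  · rw [dQry_eq_nil x a hg]; exact hx

/-! ### The oracle machine -/

/-- The verdict language `{⟨x, a⟩ | dOut = 1}`. [folklore] -/
def dsrLang : Language Bool := {p | dOut p = [true]}

/-- `dsrLang ∈ P`. [folklore] -/
theorem dsrLang_mem_P : dsrLang ∈ Classes.P := setOf_apply_eq_apply_mem_P dOut_mem_FP.2.2.2.2.2 (const_mem_FP [true])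

/-- **The downward self-reduction machine of `LTV`** (Boolean outputs): the bounded adaptive algorithm
asking `dQry` for `2|x|` rounds and deciding by `dOut`. [cite: TrevisanVadhan2007, Thm. 4.3 (proof, (b))] [cite: ImpagliazzoWigderson2001, Def. 6] -/
def dsrAlgB : OracleAlg Bool := AdQuery.adAlg dQry (2 * X) dsrLang

/-- **The downward self-reduction machine of `LTV`**, outputs presented as one-bit strings (the type of
IW's Def. 6 hypotheses in the tree). [cite: ImpagliazzoWigderson2001, Def. 6] -/
def dsrAlg : OracleAlg (List Bool) := dsrAlgB.mapOut encodeBool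

/-- **The machine is polynomial time.** [cite: AroraBarakCC2009, §3.4] -/
theorem dsrAlg_isPolyTime : dsrAlg.IsPolyTime (encodingList Bool) :=
  (AdQuery.isPolyTime_adAlg (Q := dQry) (q := 2 * X) (D := dsrLang) dQry_mem_FP dsrLang_mem_P).mapOut encodeBool fun _ => rfl

/-- Every query of a bounded adaptive algorithm is its generator on the input and some string. [folklore] -/
theorem exists_eq_of_mem_queries_adAlg (Q : List Bool → List Bool) (q : Polynomial ℕ) (D : Language Bool) (O : Oracle) (k : ℕ)
    (x y : List Bool) (hy : y ∈ (AdQuery.adAlg Q q D).queries O k x) : ∃ t : List Bool, y = Q (boolPair x t) := by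
  obtain ⟨i, -, hall, rfl⟩ := OracleCompose.exists_of_mem_queries _ O k x y hy
  obtain ⟨y', hy'⟩ := hall i le_rfl
  refine ⟨(PRelSigma.trans (AdQuery.adAlg Q q D) O x i).flatten, ?_⟩
  rw [PRelSigma.qryOf_eq_of_step_eq hy']
  by_cases hlt : (PRelSigma.trans (AdQuery.adAlg Q q D) O x i).length < q.eval x.length
  · rw [AdQuery.adAlg_step_of_lt (Q := Q) (q := q) (D := D) x hlt] at hy'
    exact (Sum.inl.inj hy').symm
  · rw [AdQuery.adAlg_step_of_le (Q := Q) (q := q) (D := D) x (not_lt.1 hlt)] at hy'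
    cases hy'

/-- With no round available the adaptive algorithm asks nothing. [folklore] -/
theorem queries_adAlg_of_eval_eq_zero (Q : List Bool → List Bool) (q : Polynomial ℕ) (D : Language Bool) (O : Oracle) (k : ℕ)
    (x : List Bool) (h0 : q.eval x.length = 0) : (AdQuery.adAlg Q q D).queries O k x = [] := by
  cases k with
  | zero => rfl
  | succ k =>
    simp only [OracleAlg.queries, OracleAlg.queriesAux, AdQuery.adAlg, h0, Nat.not_lt_zero, List.length_nil, if_false]

/-- The `m`-th genuine query (total in `m`). [folklore] -/
def qryAt (x : List Bool) (hi : iOf x.length < mlen (nOf x.length)) (m : ℕ) : List Bool :=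
  wordOf (nOf x.length) (Function.update (xOf (nOf x.length) x) (opVar ((uops (nOf x.length))[iOf x.length]'(by rwa [mlen] at hi)))
    (if m < blk (nOf x.length) then 0 else 1)) ⟨m % blk (nOf x.length), Nat.mod_lt _ (blk_pos _)⟩ (h (nOf x.length) (iOf x.length + 1))

/-- The indicator of `LTV` is `F`. [folklore] -/
theorem boolIndicator_LTV (w : List Bool) : LTV.boolIndicator w = FB w := by
  cases hF : FB w
  · exact (Set.notMem_iff_boolIndicator _ _).1 (by simp [LTV, hF])
  · exact (Set.mem_iff_boolIndicator _ _).1 hF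

/-- The answer bits of the adaptive run against `LTV`: the bits of `F` at the genuine queries. [folklore] -/
theorem adBits_eq (x : List Bool) (hc : ptLen (nOf x.length) + blk (nOf x.length) ≤ x.length - pre (nOf x.length))
    (hpos : 0 < nOf x.length) (hi : iOf x.length < mlen (nOf x.length)) :
    ∀ k ≤ 2 * blk (nOf x.length), AdQuery.adBits dQry LTV x k = List.ofFn fun m : Fin k => FB (qryAt x hi m.val)
  | 0, _ => rfl
  | k + 1, hk => by
    rw [AdQuery.adBits_succ, dQry_apply x _ hc hpos hi (by rw [AdQuery.length_adBits]; omega), AdQuery.length_adBits,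
      adBits_eq x hc hpos hi k (Nat.le_of_succ_le hk), boolIndicator_LTV, List.ofFn_succ', List.concat_eq_append]
    rfl

/-- The `2 blk n` genuine answer bits, as the two blocks `dOut_eq_FB` expects. [folklore] -/
theorem ofFn_qryAt_eq (x : List Bool) (hi : iOf x.length < mlen (nOf x.length)) :
    (List.ofFn fun m : Fin (2 * blk (nOf x.length)) => FB (qryAt x hi m.val)) =
      (List.ofFn fun l : Fin (blk (nOf x.length)) => FB (wordOf (nOf x.length)
          (Function.update (xOf (nOf x.length) x) (opVar ((uops (nOf x.length))[iOf x.length]'(by rwa [mlen] at hi))) 0) l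
          (h (nOf x.length) (iOf x.length + 1)))) ++
      (List.ofFn fun l : Fin (blk (nOf x.length)) => FB (wordOf (nOf x.length)
          (Function.update (xOf (nOf x.length) x) (opVar ((uops (nOf x.length))[iOf x.length]'(by rwa [mlen] at hi))) 1) l
          (h (nOf x.length) (iOf x.length + 1)))) := by
  set b := blk (nOf x.length) with hbdef
  have hb : b = Mof (nOf x.length) + 1 := rfl
  apply List.ext_getElem
  · rw [List.length_ofFn, List.length_append, List.length_ofFn, List.length_ofFn, two_mul]
  · intro p h1 h2
    rw [List.length_ofFn] at h1
    rw [List.getElem_ofFn]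
    by_cases hp : p < b
    · rw [List.getElem_append_left (by rw [List.length_ofFn]; exact hp), List.getElem_ofFn, qryAt, if_pos hp]
      have hsel : (⟨p % b, Nat.mod_lt _ (blk_pos _)⟩ : Fin b) = ⟨p, hp⟩ := Fin.ext (Nat.mod_eq_of_lt hp)
      rw [hsel]
    · rw [List.getElem_append_right (by rw [List.length_ofFn]; exact not_lt.1 hp), List.getElem_ofFn, qryAt, if_neg hp]
      have hsel : (⟨p % b, Nat.mod_lt _ (blk_pos _)⟩ : Fin b) = ⟨p - (List.ofFn fun l : Fin b => FB (wordOf (nOf x.length)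
          (Function.update (xOf (nOf x.length) x) (opVar ((uops (nOf x.length))[iOf x.length]'(by rwa [mlen] at hi))) 0) l
          (h (nOf x.length) (iOf x.length + 1)))).length, by rw [List.length_ofFn]; omega⟩ := by
        apply Fin.ext
        simp only [List.length_ofFn]
        rw [Nat.mod_eq_sub_mod (not_lt.1 hp), Nat.mod_eq_of_lt (by omega)]
      rw [hsel]

/-- **THE DOWNWARD SELF-REDUCTION OF `LTV`** (Impagliazzo–Wigderson's Def. 6 / Murray–Williams' Def. 2.5,
machine form): against EVERY oracle answering `LTV` on the words shorter than `x`, within `2|x| + 1`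
rounds the machine outputs `[x ∈ LTV]`. [cite: TrevisanVadhan2007, Thm. 4.3 (proof, (b))] [cite: ImpagliazzoWigderson2001, Def. 6] -/
theorem dsrAlg_run (x : List Bool) (O : Oracle) (hO : ∀ y : List Bool, y.length < x.length → O y = Oracle.ofLanguage LTV y) :
    dsrAlg.run O ((2 * X + 1 : Polynomial ℕ).eval x.length) x = some (Oracle.ofLanguage LTV x) := by
  have hq : ∀ y ∈ dsrAlg.queries O ((2 * X + 1 : Polynomial ℕ).eval x.length) x, O y = Oracle.ofLanguage LTV y := by
    intro y hy
    have hy' : y ∈ dsrAlgB.queries O ((2 * X + 1 : Polynomial ℕ).eval x.length) x := by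
      simpa [dsrAlg, OracleAlg.queries, OracleAlg.queriesAux_mapOut] using hy
    rcases Nat.eq_zero_or_pos x.length with h0 | hx
    · rw [dsrAlgB, queries_adAlg_of_eval_eq_zero _ _ _ _ _ _ (by simp [h0])] at hy'
      simp at hy'
    · obtain ⟨t, rfl⟩ := exists_eq_of_mem_queries_adAlg _ _ _ _ _ _ _ hy'
      exact hO _ (dQry_length_lt x t hx)
  rw [OracleAlg.run_congr_oracle _ _ _ _ _ hq, dsrAlg, OracleAlg.run, OracleAlg.runAux_mapOut, ← OracleAlg.run, dsrAlgB,
    AdQuery.run_adAlg (Q := dQry) (q := 2 * X) (D := dsrLang) LTV x (by simp)]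
  show some (encodeBool ((AdQuery.adLang dQry (2 * X) dsrLang LTV).boolIndicator x)) = some (Oracle.ofLanguage LTV x)
  rw [Oracle.ofLanguage_apply]
  congr 2
  -- the adaptive language is `LTV`
  have hmem : x ∈ AdQuery.adLang dQry (2 * X) dsrLang LTV ↔ x ∈ LTV := by
    rw [AdQuery.mem_adLang_iff]
    change dOut (boolPair x (AdQuery.adBits dQry LTV x ((2 * X : Polynomial ℕ).eval x.length))) = [true] ↔ FB x = true
    rw [dOut_eq_FB x _ (fun hc hpos hi => ⟨(AdQuery.adBits dQry LTV x ((2 * X : Polynomial ℕ).eval x.length)).drop (2 * blk (nOf x.length)), ?_⟩)]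
    · simp
    · have h2 : 2 * blk (nOf x.length) ≤ (2 * X : Polynomial ℕ).eval x.length := by
        simp only [eval_mul, eval_ofNat, eval_X]
        have := (nOf_spec x.length).1; omega
      conv_lhs => rw [← List.take_append_drop (2 * blk (nOf x.length)) (AdQuery.adBits dQry LTV x _)]
      rw [AdQuery.adBits_take LTV x h2, adBits_eq x hc hpos hi _ le_rfl, ofFn_qryAt_eq x hi, List.append_assoc]
  by_cases hx : x ∈ LTV
  · rw [(Set.mem_iff_boolIndicator _ _).1 hx, (Set.mem_iff_boolIndicator _ _).1 (hmem.2 hx)]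
  · rw [(Set.notMem_iff_boolIndicator _ _).1 hx, (Set.notMem_iff_boolIndicator _ _).1 (fun h => hx (hmem.1 h))]

end TVChk

/-! ### Murray–Williams from the `PSPACE`-hardness of `LTV` alone -/

open QBFUniv in
/-- **Murray–Williams' Thm. 2.2 language from the `PSPACE`-hardness of `LTV`**: the downward
self-reduction machine is `TVChk.dsrAlg`, the same-length checker the tower of `TVCheckerMachine.lean`.
[cite: MurrayWilliams2018, Thm. 2.2 (SIAM Thm. 2.7)] [cite: TrevisanVadhan2007, Thm. 4.3, Thm. 5.4] -/
theorem MurrayWilliams2018_thm_2_2_language_of_isHard_LTV (hhard : IsHard PSPACE LTV) :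
    ∃ L : Language Bool, IsHard PSPACE L ∧ (∀ x : List Bool, true :: x ∈ L ↔ x ∈ L) ∧
      (∀ n : ℕ, List.replicate n true ∉ L) ∧ Nonempty (AlmostAE.DSR L) ∧ Nonempty (AlmostAE.SameLengthChecker L) :=
  MurrayWilliams2018_thm_2_2_language_of_LTV hhard TVChk.dsrAlg TVChk.dsrAlg_isPolyTime (2 * X + 1) TVChk.dsrAlg_run

open QBFUniv in
/-- **`NQP ⊄ ACC⁰` from the `PSPACE`-hardness of Trevisan–Vadhan's `LTV` — nothing else.**
[cite: MurrayWilliams2018, §1.1, Thm. 1.3, Thm. 2.2, Thm. 3.1] [cite: Santhanam2009, Lemma 12] [cite: TrevisanVadhan2007, Thm. 4.3, Thm. 5.4] -/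
theorem MurrayWilliams2018_NQP_not_subset_ACC0_of_isHard_LTV (hhard : IsHard PSPACE LTV) : MurrayWilliams2018_NQP_not_subset_ACC0 :=
  MurrayWilliams2018_NQP_not_subset_ACC0_of_LTV hhard TVChk.dsrAlg TVChk.dsrAlg_isPolyTime (2 * X + 1) TVChk.dsrAlg_run

open QBFUniv in
/-- **Lemma 4.1 (a.e. form) from the `PSPACE`-hardness of `LTV` and a generator of Umans' type.**
[cite: MurrayWilliams2018, Lemma 4.1, Thm. 2.1, Thm. 2.2, Thm. 3.1] -/
theorem MurrayWilliams2018_lemma_4_1_ae_of_isHard_LTV_of_umansGenerator (hhard : IsHard PSPACE LTV) (G : UmansGenerator) :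
    MurrayWilliams2018_lemma_4_1_ae :=
  MurrayWilliams2018_lemma_4_1_ae_of_LTV_of_umansGenerator hhard TVChk.dsrAlg TVChk.dsrAlg_isPolyTime (2 * X + 1) TVChk.dsrAlg_run G

end Literature.Computability.Complexity

end
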